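import Literature.MathematicalPhysics.StatisticalMechanics.HardCoreCanonical
import Literature.MathematicalPhysics.KineticTheory.HardSphereEulerProofs
import Literature.Analysis.FluidPDE.HardSphereTorusMeasure

/-!
# The canonical hard-sphere gas on `𝕋³` at low density: size-form expansions and the cluster limit

Topic `Literature/MathematicalPhysics/KineticTheory` (third of four files proving the named fact
`Literature.MathematicalPhysics.KineticTheory.localGibbs_densityLLN` of `HardSphereEulerProofs` — hence `localGibbs_lln` of
`HardSphereEuler` — in `HardSphereEulerLLN`; the first two are
`Probability/LatticeModels/HardCoreUrsell` and `StatisticalMechanics/HardCoreCanonical`).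

The abstract canonical hard-core gas of `HardCoreCanonical` is specialised to `n` labelled points
of the flat torus `𝕋³` with common law `μ = β(y) dy` — `β` a continuous positive probability
density (`DensityProfile`; for a local Gibbs state, the normalised activity `a₀ / ∫ a₀`) — and the
overlap relation "minimal-image distance `< ε`" (`Ov`), whose hard-core set is the non-overlap set
`posDomain ε n` of `HardSphereEulerProofs` (`hardCoreSet_ov_univ`).

* **Overlap scale** (`μ_ov_le_pOv`): `μ{y : d(z, y) < ε} ≤ p_ε := M v₁ ε³` for `ε < 1/2`, with
  `M = sup β` and `v₁` the volume of the unit ball of `ℝ³` (at the scaling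
  `ε_N = σ (N+1)^{-1/3}` of `hsDiameter`, `(N+1) p_{ε_N} = M v₁ σ³` is the small parameter of
  `HardSphereEulerLLN`).
* **Size forms of the expansions** (`Xi`, `Wd`, `Md`; `Md_eq_sum`, `Xi_eq_sum`, `abs_Wd_le`,
  `integral_two_point_eq`, `abs_sameBlockRem_le`): by the relabelling symmetry of
  `HardCoreCanonical`, the hard-core probability `Ξ(m)` of the first `m` labels, the decorated
  activities `W^g(k)` and the decorated partition functions `M^g(m)` only depend on the number of
  labels, and the decorated Mayer expansions become
  `M^g(m) = ∑_{j<m} C(m-1, j) W^g(j+1) Ξ(m-1-j)` — with `g = 1` the recursion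
  `Ξ(m) = ∑_{j<m} C(m-1, j) w(j+1) Ξ(m-1-j)` for the canonical partition functions —, the
  two-point version with an explicit same-block remainder, and the tree bound
  `|W^g(k)| ≤ C t(k) p_ε^{k-1}`; the insertion bound reads `Ξ(m+1) ≥ Ξ(m) (1 - m p_ε)`
  (`Xi_succ_ge`).
* **The cluster limit** (`tendsto_choose_mul_Wd`, `tendsto_choose_sub_mul_Wd`): for `σ > 0`,
  bounded measurable `g` and every `k`,
  `C(N, k) W^g_{ε_N}(k+1) → γ_k ∫ g β^{k+1}` as `N → ∞`, `γ_k = σ^{3k} b_k / k!` (`clusterCoeff`),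
  where `b_k = ∫_{(ℝ³)^k} c₁(0, z₁, …, z_k) dz` (`bE`) is the integrated Ursell coefficient of
  `k + 1` unit-diameter spheres with one pinned at the origin. Proof: the activity only involves
  its block (`Wd_eq_Wd_self`); split off the marked point and translate the others
  (`Wd_self_eq_integral_translate`); lift the remaining `k` points to `ℝ³` through the chart
  `proj` on the symmetric cube (`integral_cT_eq_integral_cE`, `cT_proj_eq_cE`: a nonvanishing
  Ursell coefficient forces a connected overlap graph, so all points lie within `k ε < 1/4` of the
  root, where the chart is isometric); scale by `ε` (`Wd_self_eq_pow_mul`, an exact identity once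
  `k ε < 1/4`); and let `ε → 0` by dominated convergence (`tendsto_Jint`,
  `tendsto_integral_Jint`: continuity of `β`, compact support and boundedness of `c₁`), together
  with `C(N, k) ε_N^{3k} → σ^{3k} / k!` (`tendsto_choose_mul_hsDiameter_pow`).

This is the torus version, for the hard-core interaction and a non-constant one-body density, of
the set-up of the canonical-ensemble cluster expansion of Pulvirenti–Tsagkarogiannis (2012),
§3 (polymer representation on vertex sets) and §4 (tree-graph bounds), in the elementary form
needed for the density law of large numbers; the identification of the limit is carried out in
`HardSphereEulerLLN`.

## References

* E. Pulvirenti, D. Tsagkarogiannis, *Cluster expansion in the canonical ensemble*, Comm. Math.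
  Phys. 316 (2012) 289–306, §3–4. [PulvirentiTsagkarogiannis2012]
* H. Spohn, *Large Scale Dynamics of Interacting Particles*, Springer 1991, Part I §2.3
  (local equilibrium states and their law of large numbers). [Spohn1991]
-/

namespace Literature.MathematicalPhysics.KineticTheory

open MeasureTheory ProbabilityTheory Finset Filter Topology Literature.Probability.LatticeModels StatisticalMechanics Literature.Analysis.FluidPDE.Torus Literature.Analysis.FunctionSpaces.Torus
open scoped ENNReal

noncomputable section

/-! ### The overlap relation at scale `ε` on `𝕋³` -/

/-- Two points of `𝕋³` **overlap at scale `ε`**: minimal-image distance `< ε`. [folklore] -/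
def Ov (ε : ℝ) (y y' : T3) : Prop := Literature.Analysis.FluidPDE.Torus.euclidDist y y' < ε

/-- Overlap is symmetric. [folklore] -/
theorem ov_symm (ε : ℝ) : ∀ a b : T3, Ov ε a b → Ov ε b a := by
  intro a b h
  unfold Ov at h ⊢
  rwa [Literature.Analysis.FluidPDE.Torus.euclidDist_comm]

/-- The minimal-image distance is jointly continuous. [folklore] -/
theorem continuous_euclidDist_prod :
    Continuous fun p : T3 × T3 => Literature.Analysis.FluidPDE.Torus.euclidDist p.1 p.2 := by
  simp_rw [euclidDist_eq_sqrt]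
  fun_prop

/-- The overlap set is measurable (it is open). [folklore] -/
theorem measurableSet_ov (ε : ℝ) : MeasurableSet {p : T3 × T3 | Ov ε p.1 p.2} :=
  (isOpen_lt continuous_euclidDist_prod continuous_const).measurableSet

/-- The **triangle inequality** for the minimal-image distance. [folklore] -/
theorem euclidDist_triangle (x y z : T3) :
    Literature.Analysis.FluidPDE.Torus.euclidDist x z ≤ Literature.Analysis.FluidPDE.Torus.euclidDist x y + Literature.Analysis.FluidPDE.Torus.euclidDist y z := by
  have h := Literature.Analysis.FluidPDE.Torus.euclidDist_translate_le x y (0 : EuclideanSpace ℝ (Fin 3)) (reprSym (z - y))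
  rw [proj_zero, add_zero, proj_reprSym, add_sub_cancel, zero_sub, norm_neg] at h
  calc _ ≤ _ := h
    _ = _ := by rw [← Literature.Analysis.FluidPDE.Torus.euclidDist_eq, Literature.Analysis.FluidPDE.Torus.euclidDist_comm z y]

/-- The hard-core set of all labels at scale `ε` is the non-overlap set `posDomain`. [folklore] -/
theorem hardCoreSet_ov_univ (ε : ℝ) (n : ℕ) :
    hardCoreSet (Ov ε) (univ : Finset (Fin n)) = posDomain ε n := by
  ext x
  simp only [hardCoreSet, Ov, mem_univ, true_implies, not_lt, Set.mem_setOf_eq, posDomain]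

/-! ### Density profiles and the one-particle law -/

/-- A **density profile**: a continuous, positive probability density on `𝕋³` (the normalised
activity `a₀ / ∫ a₀`). [folklore] -/
structure DensityProfile where
  /-- the density -/
  β : T3 → ℝ
  continuous : Continuous β
  pos : ∀ y, 0 < β y
  integral_eq_one : ∫ y, β y = 1

namespace DensityProfile

variable (P : DensityProfile)

/-- The one-particle law `β(y) dy`. [folklore] -/
def μ : Measure T3 := volume.withDensity fun y => ENNReal.ofReal (P.β y)

/-- The supremum of the density. [folklore] -/
def M : ℝ := sSup (Set.range P.β)

/-- The range of the density is bounded above (continuity, compactness). [folklore] -/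
theorem bddAbove_range : BddAbove (Set.range P.β) :=
  (isCompact_range P.continuous).bddAbove

/-- `β ≤ M`. [folklore] -/
theorem le_M (y : T3) : P.β y ≤ P.M := le_csSup P.bddAbove_range ⟨y, rfl⟩

/-- `0 < M`. [folklore] -/
theorem M_pos : 0 < P.M := (P.pos 0).trans_le (P.le_M 0)

/-- The one-particle law is a probability measure. [folklore] -/
instance isProbabilityMeasure_μ : IsProbabilityMeasure P.μ := by
  constructor
  rw [μ, withDensity_apply _ MeasurableSet.univ, Measure.restrict_univ,
    ← ofReal_integral_eq_lintegral_ofReal (integrable_of_continuous_T3 P.continuous)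
      (ae_of_all _ fun y => (P.pos y).le), P.integral_eq_one, ENNReal.ofReal_one]

/-- Integration against the one-particle law. [folklore] -/
theorem integral_μ (f : T3 → ℝ) : ∫ y, f y ∂P.μ = ∫ y, P.β y * f y := by
  rw [μ, integral_withDensity_eq_integral_toReal_smul]
  · refine integral_congr_ae (ae_of_all _ fun y => ?_)
    simp only [ENNReal.toReal_ofReal (P.pos y).le, smul_eq_mul]
  · exact ENNReal.measurable_ofReal.comp P.continuous.measurable
  · exact ae_of_all _ fun _ => ENNReal.ofReal_lt_top

/-- The `μ`-measure of a set is at most `M` times its Haar measure. [folklore] -/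
theorem μ_le (s : Set T3) : P.μ s ≤ ENNReal.ofReal P.M * volume s := by
  calc P.μ s ≤ (volume.withDensity fun _ => ENNReal.ofReal P.M) s := by
        refine withDensity_mono (ae_of_all _ fun y => ENNReal.ofReal_le_ofReal (P.le_M y)) s
    _ = ENNReal.ofReal P.M * volume s := by rw [withDensity_const, Measure.smul_apply, smul_eq_mul]

end DensityProfile

/-- The Lebesgue measure of the unit ball of `ℝ³`. [folklore] -/
def v₁ : ℝ := (volume (Metric.ball (0 : EuclideanSpace ℝ (Fin 3)) 1)).toReal

/-- The unit ball has positive volume. [folklore] -/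
theorem v₁_pos : 0 < v₁ := by
  unfold v₁
  refine ENNReal.toReal_pos (Metric.measure_ball_pos volume _ one_pos).ne' measure_ball_lt_top.ne

/-- The **overlap probability bound**: `μ{y' : d(z, y') < ε} ≤ M · v₁ · ε³` for `ε < 1/2`.
[folklore] -/
theorem μ_ov_le (P : DensityProfile) {ε : ℝ} (hε : 0 ≤ ε) (hε2 : ε < 1 / 2) (z : T3) :
    P.μ {y | Ov ε z y} ≤ ENNReal.ofReal (P.M * v₁ * ε ^ 3) := by
  have hset : {y : T3 | Ov ε z y} = {y | Literature.Analysis.FluidPDE.Torus.euclidDist y z < ε} := by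
    ext y; simp [Ov, Literature.Analysis.FluidPDE.Torus.euclidDist_comm]
  rw [hset]
  refine (P.μ_le _).trans ?_
  rw [Literature.Analysis.FluidPDE.Torus.volume_euclidDist_lt hε2, Measure.addHaar_ball volume _ hε, finrank_euclideanSpace,
    Fintype.card_fin, mul_assoc, ENNReal.ofReal_mul P.M_pos.le, mul_comm v₁,
    ENNReal.ofReal_mul (pow_nonneg hε 3)]
  gcongr
  rw [v₁, ENNReal.ofReal_toReal measure_ball_lt_top.ne]

/-- The **overlap scale** `p_ε = M v₁ ε³` bounding the one-particle overlap probabilities. [folklore] -/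
def pOv (P : DensityProfile) (ε : ℝ) : ℝ := P.M * v₁ * ε ^ 3

/-- `0 ≤ p_ε`. [folklore] -/
theorem pOv_nonneg (P : DensityProfile) {ε : ℝ} (hε : 0 ≤ ε) : 0 ≤ pOv P ε := by
  unfold pOv; have := P.M_pos; have := v₁_pos; positivity

/-- The one-particle overlap probabilities are at most `p_ε`. [folklore] -/
theorem μ_ov_le_pOv (P : DensityProfile) {ε : ℝ} (hε : 0 ≤ ε) (hε2 : ε < 1 / 2) (z : T3) :
    P.μ {y | Ov ε z y} ≤ ENNReal.ofReal (pOv P ε) := μ_ov_le P hε hε2 z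

/-! ### The canonical hard-sphere quantities of `n` labelled particles at scale `ε` -/

section Canonical

/-- The first `m` labels `{0, …, m-1} ⊆ Fin n`. [folklore] -/
def firstLabels (n m : ℕ) : Finset (Fin n) := univ.filter fun i : Fin n => (i : ℕ) < m

/-- Membership in `firstLabels`. [folklore] -/
theorem mem_firstLabels {n m : ℕ} {i : Fin n} : i ∈ firstLabels n m ↔ (i : ℕ) < m := by
  simp [firstLabels]

/-- `firstLabels n m` has `m` elements for `m ≤ n`. [folklore] -/
theorem card_firstLabels {n m : ℕ} (h : m ≤ n) : (firstLabels n m).card = m := by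
  rw [firstLabels, Fin.card_filter_val_lt, min_eq_right h]

/-- All `n` labels. [folklore] -/
theorem firstLabels_self (n : ℕ) : firstLabels n n = univ := by
  ext i; simp [firstLabels]

/-- No labels. [folklore] -/
theorem firstLabels_zero (n : ℕ) : firstLabels n 0 = ∅ := by
  ext; simp [firstLabels]

/-- `firstLabels` is monotone. [folklore] -/
theorem firstLabels_mono {n m m' : ℕ} (h : m ≤ m') : firstLabels n m ⊆ firstLabels n m' :=
  fun _ hi => mem_firstLabels.2 ((mem_firstLabels.1 hi).trans_le h)

/-- The label `0` is among the first `m ≥ 1`. [folklore] -/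
theorem zero_mem_firstLabels {n m : ℕ} [NeZero n] (hm : 1 ≤ m) : (0 : Fin n) ∈ firstLabels n m :=
  mem_firstLabels.2 (by simp; omega)

/-- `firstLabels n (m+1) = insert ⟨m⟩ (firstLabels n m)` for `m < n`. [folklore] -/
theorem firstLabels_succ {n m : ℕ} (h : m < n) :
    firstLabels n (m + 1) = insert ⟨m, h⟩ (firstLabels n m) := by
  ext i
  simp only [mem_firstLabels, mem_insert, Fin.ext_iff]
  omega

/-- The label `m` is not among the first `m`. [folklore] -/
theorem notMem_firstLabels {n m : ℕ} (h : m < n) : (⟨m, h⟩ : Fin n) ∉ firstLabels n m := by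
  simp [mem_firstLabels]

variable (P : DensityProfile) (ε : ℝ) (n : ℕ)

/-- `Ξ_n(m)`: the probability that the first `m` of `n` independent `μ`-distributed points of `𝕋³`
are mutually at minimal-image distance `≥ ε` (the canonical hard-sphere partition function of `m`
particles normalised by the ideal-gas one). [cite: PulvirentiTsagkarogiannis2012, §3] -/
def Xi (m : ℕ) : ℝ := hcProb (Ov ε) P.μ (firstLabels n m)

/-- `W^g(k)`: the decorated activity of a `k`-block marked at the label `0`.
[cite: PulvirentiTsagkarogiannis2012, §3] -/
def Wd [NeZero n] (g : T3 → ℝ) (k : ℕ) : ℝ := decAct (Ov ε) P.μ g (0 : Fin n) (firstLabels n k)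

/-- `M^g(m)`: the decorated partition function of the first `m` labels marked at `0`.
[cite: PulvirentiTsagkarogiannis2012, §3] -/
def Md [NeZero n] (g : T3 → ℝ) (m : ℕ) : ℝ := decPF (Ov ε) P.μ g (0 : Fin n) (firstLabels n m)

variable {P ε n}

/-- `Ξ_n(0) = 1`. [folklore] -/
theorem Xi_zero : Xi P ε n 0 = 1 := by
  rw [Xi, firstLabels_zero, hcProb]
  have : hardCoreSet (Ov ε) (∅ : Finset (Fin n)) = Set.univ := by
    ext x; simp [hardCoreSet]
  rw [this]; simp

/-- `0 ≤ Ξ`. [folklore] -/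
theorem Xi_nonneg (m : ℕ) : 0 ≤ Xi P ε n m := hcProb_nonneg _ _

/-- `Ξ ≤ 1`. [folklore] -/
theorem Xi_le_one (m : ℕ) : Xi P ε n m ≤ 1 := hcProb_le_one _ _

/-- `Ξ` decreases when a particle is added. [folklore] -/
theorem Xi_succ_le (m : ℕ) : Xi P ε n (m + 1) ≤ Xi P ε n m :=
  hcProb_mono _ (firstLabels_mono (Nat.le_succ m))

/-- **Insertion bound**: `Ξ_n(m+1) ≥ Ξ_n(m) (1 - m p_ε)` for `m < n`. [folklore] -/
theorem Xi_succ_ge (hε : 0 ≤ ε) (hε2 : ε < 1 / 2) {m : ℕ} (hm : m < n) :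
    Xi P ε n m * (1 - m * pOv P ε) ≤ Xi P ε n (m + 1) := by
  have h := hcProb_insert_ge P.μ (measurableSet_ov ε) (ov_symm ε) (pOv_nonneg P hε)
    (μ_ov_le_pOv P hε hε2) (notMem_firstLabels hm)
  rw [card_firstLabels hm.le] at h
  rwa [Xi, Xi, firstLabels_succ hm]

/-- With `g = 1` the decorated partition function is `Ξ`. [folklore] -/
theorem Md_one [NeZero n] (m : ℕ) : Md P ε n (fun _ => 1) m = Xi P ε n m := by
  rw [Md, decPF, Xi, ← integral_efR P.μ (measurableSet_ov ε)]
  simp only [one_mul]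

/-- `W^g(1) = ∫ g dμ` (the Ursell weight of a singleton is `1`). [folklore] -/
theorem Wd_one [NeZero n] {g : T3 → ℝ} (hg : Measurable g) : Wd P ε n g 1 = ∫ y, g y ∂P.μ := by
  have h1 : firstLabels n 1 = {(0 : Fin n)} := by
    ext i
    rw [mem_firstLabels, mem_singleton, Fin.ext_iff, Fin.val_zero, Nat.lt_one_iff]
  rw [Wd, decAct, h1]
  simp only [uR, hcUrsell_singleton, Int.cast_one, mul_one]
  have hmp := measurePreserving_eval (fun _ : Fin n => P.μ) (0 : Fin n)
  conv_rhs => rw [← hmp.map_eq]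
  rw [integral_map (measurable_pi_apply 0).aemeasurable]
  rw [hmp.map_eq]; exact hg.aestronglyMeasurable

/-! ### Regrouping sums over blocks by cardinality -/

/-- Summing a function of the cardinality over the subsets of `W` containing `a`:
`∑_{B ∋ a} φ(#B) = ∑_{j < #W} C(#W - 1, j) φ(j+1)`. [folklore] -/
theorem sum_filter_mem_card {α : Type*} [DecidableEq α] {M : Type*} [AddCommMonoid M]
    (W : Finset α) {a : α} (ha : a ∈ W) (φ : ℕ → M) :
    ∑ B ∈ W.powerset.filter (fun B => a ∈ B), φ B.card =
      ∑ j ∈ range W.card, (W.card - 1).choose j • φ (j + 1) := by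
  rw [sum_filter_mem_eq_sum_powerset_erase W ha]
  have h1 : ∀ Q ∈ (W.erase a).powerset, φ (insert a Q).card = φ (Q.card + 1) := by
    intro Q hQ
    rw [card_insert_of_notMem fun h => (mem_erase.1 (mem_powerset.1 hQ h)).1 rfl]
  rw [sum_congr rfl h1, sum_powerset_apply_card (fun k => φ (k + 1)), card_erase_of_mem ha,
    Nat.sub_add_cancel (card_pos.2 ⟨a, ha⟩)]

/-- Subsets containing `a` but not `b`: `∑ φ(#B) = ∑_{j < #W - 1} C(#W - 2, j) φ(j+1)`. [folklore] -/
theorem sum_filter_mem_not_mem_card {α : Type*} [DecidableEq α] {M : Type*} [AddCommMonoid M]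
    (W : Finset α) {a b : α} (ha : a ∈ W) (hb : b ∈ W) (hab : a ≠ b) (φ : ℕ → M) :
    ∑ B ∈ (W.powerset.filter (fun B => a ∈ B)).filter (fun B => b ∉ B), φ B.card =
      ∑ j ∈ range (W.card - 1), (W.card - 2).choose j • φ (j + 1) := by
  have hset : (W.powerset.filter (fun B => a ∈ B)).filter (fun B => b ∉ B) =
      (W.erase b).powerset.filter (fun B => a ∈ B) := by
    ext B
    simp only [mem_filter, mem_powerset, subset_erase]
    tauto
  rw [hset, sum_filter_mem_card (W.erase b) (mem_erase.2 ⟨hab, ha⟩), card_erase_of_mem hb]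
  rfl

/-- Subsets containing both `a` and `b`: `∑ φ(#B) = ∑_{j < #W - 1} C(#W - 2, j) φ(j+2)`. [folklore] -/
theorem sum_filter_mem_mem_card {α : Type*} [DecidableEq α] {M : Type*} [AddCommMonoid M]
    (W : Finset α) {a b : α} (ha : a ∈ W) (hb : b ∈ W) (hab : a ≠ b) (φ : ℕ → M) :
    ∑ B ∈ (W.powerset.filter (fun B => a ∈ B)).filter (fun B => b ∈ B), φ B.card =
      ∑ j ∈ range (W.card - 1), (W.card - 2).choose j • φ (j + 2) := by
  -- remove `b`: bijection with the subsets of `W \ b` containing `a`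
  have key : ∑ B ∈ (W.powerset.filter (fun B => a ∈ B)).filter (fun B => b ∈ B), φ B.card =
      ∑ B' ∈ (W.erase b).powerset.filter (fun B => a ∈ B), φ (B'.card + 1) := by
    refine sum_nbij' (fun B => B.erase b) (fun B' => insert b B') ?_ ?_ ?_ ?_ ?_
    · intro B hB
      simp only [mem_filter, mem_powerset] at hB ⊢
      exact ⟨erase_subset_erase b hB.1.1, mem_erase.2 ⟨hab, hB.1.2⟩⟩
    · intro B' hB'
      simp only [mem_filter, mem_powerset, subset_erase] at hB' ⊢
      exact ⟨⟨insert_subset hb hB'.1.1, mem_insert_of_mem hB'.2⟩, mem_insert_self b B'⟩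
    · intro B hB
      simp only [mem_filter] at hB
      exact insert_erase hB.2
    · intro B' hB'
      simp only [mem_filter, mem_powerset, subset_erase] at hB'
      exact erase_insert hB'.1.2
    · intro B hB
      simp only [mem_filter] at hB
      rw [card_erase_add_one hB.2]
  rw [key, sum_filter_mem_card (W.erase b) (mem_erase.2 ⟨hab, ha⟩) (fun k => φ (k + 1)),
    card_erase_of_mem hb]
  rfl

/-! ### The expansions in size form -/

/-- **Decorated expansion, size form**:
`M^g(m) = ∑_{j < m} C(m-1, j) W^g(j+1) Ξ(m-1-j)` for `1 ≤ m ≤ n`. [cite: PulvirentiTsagkarogiannis2012, §3] -/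
theorem Md_eq_sum [NeZero n] {g : T3 → ℝ} (hg : Measurable g) {C : ℝ} (hgC : ∀ y, |g y| ≤ C)
    {m : ℕ} (hm1 : 1 ≤ m) (hmn : m ≤ n) :
    Md P ε n g m = ∑ j ∈ range m, ((m - 1).choose j : ℝ) * (Wd P ε n g (j + 1) * Xi P ε n (m - 1 - j)) := by
  have h0 : (0 : Fin n) ∈ firstLabels n m := zero_mem_firstLabels hm1
  rw [Md, decPF, integral_mul_efR_eq_sum P.μ (measurableSet_ov ε) h0 hg hgC]
  -- each term only depends on the size of the block
  have hterm : ∀ B ∈ (firstLabels n m).powerset.filter (fun B => (0 : Fin n) ∈ B),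
      decAct (Ov ε) P.μ g 0 B * hcProb (Ov ε) P.μ (firstLabels n m \ B) =
        Wd P ε n g B.card * Xi P ε n (m - B.card) := by
    intro B hB
    obtain ⟨hBW, h0B⟩ := mem_filter.1 hB
    have hBW' := mem_powerset.1 hBW
    have hcard : B.card ≤ m := (card_le_card hBW').trans_eq (card_firstLabels hmn)
    have hcard1 : 1 ≤ B.card := card_pos.2 ⟨0, h0B⟩
    congr 1
    · exact decAct_eq_of_card_eq P.μ (measurableSet_ov ε) hg h0B (zero_mem_firstLabels hcard1)
        (card_firstLabels (hcard.trans hmn)).symm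
    · refine hcProb_eq_of_card_eq P.μ (measurableSet_ov ε) ?_
      rw [card_sdiff_of_subset hBW', card_firstLabels hmn, card_firstLabels (by omega)]
  rw [sum_congr rfl hterm, sum_filter_mem_card (firstLabels n m) h0
    (fun k => Wd P ε n g k * Xi P ε n (m - k)), card_firstLabels hmn]
  refine sum_congr rfl fun j _ => ?_
  rw [nsmul_eq_mul, show m - 1 - j = m - (j + 1) by omega]

/-- **The recursion for `Ξ`, size form**: `Ξ(m) = ∑_{j < m} C(m-1, j) w(j+1) Ξ(m-1-j)`,
`w(k) = W^1(k)` the free activities. [cite: PulvirentiTsagkarogiannis2012, §3] -/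
theorem Xi_eq_sum [NeZero n] {m : ℕ} (hm1 : 1 ≤ m) (hmn : m ≤ n) :
    Xi P ε n m = ∑ j ∈ range m, ((m - 1).choose j : ℝ) *
      (Wd P ε n (fun _ => 1) (j + 1) * Xi P ε n (m - 1 - j)) := by
  rw [← Md_one, Md_eq_sum measurable_const (C := 1) (fun _ => by simp) hm1 hmn]

/-- **Tree bound on the activities, size form**: `|W^g(k)| ≤ C t(k) p_ε^{k-1}` for
`1 ≤ k ≤ n`, `|g| ≤ C`, `0 ≤ ε < 1/2`. [cite: PulvirentiTsagkarogiannis2012, §4] -/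
theorem abs_Wd_le [NeZero n] (hε : 0 ≤ ε) (hε2 : ε < 1 / 2) {g : T3 → ℝ} (hg : Measurable g)
    {C : ℝ} (hgC : ∀ y, |g y| ≤ C) {k : ℕ} (hk1 : 1 ≤ k) (hkn : k ≤ n) :
    |Wd P ε n g k| ≤ C * (treeNumber k * pOv P ε ^ (k - 1)) := by
  have h := abs_decAct_le P.μ (measurableSet_ov ε) (ov_symm ε) (pOv_nonneg P hε)
    (μ_ov_le_pOv P hε hε2) hg hgC (0 : Fin n) (B := firstLabels n k) ⟨0, zero_mem_firstLabels hk1⟩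
  rwa [card_firstLabels hkn] at h

/-- The same-block two-point terms. [folklore] -/
def sameBlockRem (P : DensityProfile) (ε : ℝ) (n : ℕ) [NeZero n] (h2 : 2 ≤ n) (g h : T3 → ℝ) : ℝ :=
  ∑ B ∈ ((univ : Finset (Fin n)).powerset.filter (fun B => (0 : Fin n) ∈ B)).filter
      (fun B => (⟨1, h2⟩ : Fin n) ∈ B),
    (∫ x, g (x 0) * h (x ⟨1, h2⟩) * uR (Ov ε) x B ∂Measure.pi (fun _ : Fin n => P.μ)) *
      hcProb (Ov ε) P.μ (univ \ B)

/-- **Two-point decorated expansion, size form**: for `n ≥ 2`,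
`∫ g(x₀) h(x₁) 𝟙[no overlap] = ∑_{j < n-1} C(n-2, j) W^g(j+1) M^h(n-1-j) + (same-block terms)`.
[cite: PulvirentiTsagkarogiannis2012, §3] -/
theorem integral_two_point_eq [NeZero n] (h2 : 2 ≤ n) {g h : T3 → ℝ} (hg : Measurable g)
    (hh : Measurable h) {C C' : ℝ} (hgC : ∀ y, |g y| ≤ C) (hhC : ∀ y, |h y| ≤ C') :
    ∫ x, g (x 0) * h (x ⟨1, h2⟩) * efR (Ov ε) x univ ∂Measure.pi (fun _ : Fin n => P.μ) =
      ∑ j ∈ range (n - 1), ((n - 2).choose j : ℝ) * (Wd P ε n g (j + 1) * Md P ε n h (n - 1 - j)) +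
        sameBlockRem P ε n h2 g h := by
  set i₁ : Fin n := ⟨1, h2⟩ with hi₁
  have h01 : (0 : Fin n) ≠ i₁ := by simp [hi₁, Fin.ext_iff]
  rw [integral_mul_mul_efR_eq_sum P.μ (measurableSet_ov ε) (mem_univ 0) (mem_univ i₁) hg hh hgC hhC]
  congr 1
  have hterm : ∀ B ∈ ((univ : Finset (Fin n)).powerset.filter (fun B => (0 : Fin n) ∈ B)).filter
      (fun B => i₁ ∉ B),
      decAct (Ov ε) P.μ g 0 B * ∫ x, h (x i₁) * efR (Ov ε) x (univ \ B) ∂Measure.pi (fun _ : Fin n => P.μ) =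
        Wd P ε n g B.card * Md P ε n h (n - B.card) := by
    intro B hB
    simp only [mem_filter, mem_powerset] at hB
    obtain ⟨⟨-, h0B⟩, h1B⟩ := hB
    have hcard : B.card ≤ n - 1 := by
      have : B ⊆ univ.erase i₁ := fun b hb => mem_erase.2 ⟨fun h => h1B (h ▸ hb), mem_univ b⟩
      exact (card_le_card this).trans_eq (by rw [card_erase_of_mem (mem_univ _), card_univ, Fintype.card_fin])
    have hcard1 : 1 ≤ B.card := card_pos.2 ⟨0, h0B⟩
    congr 1
    · exact decAct_eq_of_card_eq P.μ (measurableSet_ov ε) hg h0B (zero_mem_firstLabels hcard1)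
        (card_firstLabels (by omega)).symm
    · change decPF (Ov ε) P.μ h i₁ (univ \ B) = decPF (Ov ε) P.μ h 0 (firstLabels n (n - B.card))
      refine decPF_eq_of_card_eq P.μ (measurableSet_ov ε) hh (mem_sdiff.2 ⟨mem_univ _, h1B⟩)
        (zero_mem_firstLabels (by omega)) ?_
      rw [card_sdiff_of_subset (subset_univ B), card_univ, Fintype.card_fin, card_firstLabels (by omega)]
  rw [sum_congr rfl hterm, sum_filter_mem_not_mem_card univ (mem_univ 0) (mem_univ i₁) h01
    (fun k => Wd P ε n g k * Md P ε n h (n - k)), card_univ, Fintype.card_fin]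
  refine sum_congr rfl fun j _ => ?_
  rw [nsmul_eq_mul, show n - 1 - j = n - (j + 1) by omega]

/-- **Bound on the same-block terms**, keeping the partition functions:
`|same-block terms| ≤ C C' ∑_{j < n-1} C(n-2, j) t(j+2) p_ε^{j+1} Ξ(n-2-j)`. [folklore] -/
theorem abs_sameBlockRem_le [NeZero n] (h2 : 2 ≤ n) (hε : 0 ≤ ε) (hε2 : ε < 1 / 2) {g h : T3 → ℝ}
    (hg : Measurable g) (hh : Measurable h) {C C' : ℝ} (hgC : ∀ y, |g y| ≤ C) (hhC : ∀ y, |h y| ≤ C') :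
    |sameBlockRem P ε n h2 g h| ≤
      C * C' * ∑ j ∈ range (n - 1), ((n - 2).choose j : ℝ) *
        (treeNumber (j + 2) * pOv P ε ^ (j + 1) * Xi P ε n (n - 2 - j)) := by
  set i₁ : Fin n := ⟨1, h2⟩ with hi₁
  have h01 : (0 : Fin n) ≠ i₁ := by simp [hi₁, Fin.ext_iff]
  unfold sameBlockRem
  refine (abs_sum_le_sum_abs _ _).trans ?_
  have hterm : ∀ B ∈ ((univ : Finset (Fin n)).powerset.filter (fun B => (0 : Fin n) ∈ B)).filter
      (fun B => i₁ ∈ B),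
      |(∫ x, g (x 0) * h (x i₁) * uR (Ov ε) x B ∂Measure.pi (fun _ : Fin n => P.μ)) *
          hcProb (Ov ε) P.μ (univ \ B)| ≤
        C * C' * (treeNumber B.card * pOv P ε ^ (B.card - 1) * Xi P ε n (n - B.card)) := by
    intro B hB
    simp only [mem_filter] at hB
    have hcardn : B.card ≤ n := (card_le_card (subset_univ B)).trans_eq (by simp)
    have hXi : hcProb (Ov ε) P.μ (univ \ B) = Xi P ε n (n - B.card) := by
      refine hcProb_eq_of_card_eq P.μ (measurableSet_ov ε) ?_
      rw [card_sdiff_of_subset (subset_univ B), card_univ, Fintype.card_fin, card_firstLabels (by omega)]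
    rw [abs_mul, hXi, abs_of_nonneg (Xi_nonneg _)]
    have y0 : T3 := 0
    have : 0 ≤ C := (abs_nonneg _).trans (hgC y0)
    have : 0 ≤ C' := (abs_nonneg _).trans (hhC y0)
    have := pOv_nonneg P hε
    calc |∫ x, g (x 0) * h (x i₁) * uR (Ov ε) x B ∂Measure.pi (fun _ : Fin n => P.μ)| * Xi P ε n (n - B.card)
        ≤ (C * C' * (treeNumber B.card * pOv P ε ^ (B.card - 1))) * Xi P ε n (n - B.card) :=
          mul_le_mul_of_nonneg_right (abs_integral_mul_mul_uR_le P.μ (measurableSet_ov ε) (ov_symm ε)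
            (pOv_nonneg P hε) (μ_ov_le_pOv P hε hε2) hg hh hgC hhC 0 i₁ ⟨0, hB.1.2⟩) (Xi_nonneg _)
      _ = C * C' * (treeNumber B.card * pOv P ε ^ (B.card - 1) * Xi P ε n (n - B.card)) := by ring
  refine (sum_le_sum hterm).trans (le_of_eq ?_)
  rw [sum_filter_mem_mem_card univ (mem_univ 0) (mem_univ i₁) h01
    (fun k => C * C' * (treeNumber k * pOv P ε ^ (k - 1) * Xi P ε n (n - k))), card_univ,
    Fintype.card_fin, mul_sum]
  refine sum_congr rfl fun j _ => ?_
  rw [nsmul_eq_mul, show j + 2 - 1 = j + 1 by omega, show n - (j + 2) = n - 2 - j by omega]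
  ring

end Canonical

/-! ### Geometry of the chart `proj : ℝ³ → 𝕋³` near the origin -/

/-- Shorthand for `ℝ³`. [folklore] -/
abbrev E3 : Type := EuclideanSpace ℝ (Fin 3)

/-- The minimal-image distance is translation invariant. [folklore] -/
theorem euclidDist_add_left (y u v : T3) :
    Literature.Analysis.FluidPDE.Torus.euclidDist (y + u) (y + v) = Literature.Analysis.FluidPDE.Torus.euclidDist u v := by
  rw [Literature.Analysis.FluidPDE.Torus.euclidDist_eq, Literature.Analysis.FluidPDE.Torus.euclidDist_eq, add_sub_add_left_eq_sub]

/-- On the symmetric cube `reprSym ∘ proj = id` (restated from `HardSphereScattering`). [folklore] -/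
theorem reprSym_proj_of_mem_symCube' {q : E3} (hq : q ∈ Literature.Analysis.FluidPDE.Torus.symCube (Fin 3)) :
    Literature.Analysis.FluidPDE.Torus.reprSym (Literature.Analysis.FunctionSpaces.Torus.proj q) = q := by
  have h := Literature.Analysis.FluidPDE.Torus.reprSym_add_proj (x := (0 : T3)) (s := q)
    (fun i => by rw [Literature.Analysis.FluidPDE.Torus.reprSym_zero]; simpa using hq i)
  rwa [zero_add, Literature.Analysis.FluidPDE.Torus.reprSym_zero, zero_add] at h

/-- A vector of norm `< 1/2` lies in the symmetric cube. [folklore] -/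
theorem mem_symCube_of_norm_lt {q : E3} (hq : ‖q‖ < 1 / 2) : q ∈ Literature.Analysis.FluidPDE.Torus.symCube (Fin 3) := by
  intro i
  have h1 : |q i| ≤ ‖q‖ := by simpa using PiLp.norm_apply_le q i
  rw [abs_le] at h1
  constructor <;> linarith [h1.1, h1.2]

/-- For `‖q‖ < 1/2`, `reprSym (proj q) = q`. [folklore] -/
theorem reprSym_proj_of_norm_lt {q : E3} (hq : ‖q‖ < 1 / 2) : Literature.Analysis.FluidPDE.Torus.reprSym (Literature.Analysis.FunctionSpaces.Torus.proj q) = q :=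
  reprSym_proj_of_mem_symCube' (mem_symCube_of_norm_lt hq)

/-- **The chart is an isometry near the origin**: `d(proj p, proj q) = ‖p - q‖` if `‖p - q‖ < 1/2`.
[folklore] -/
theorem euclidDist_proj_proj_of_norm_lt {p q : E3} (h : ‖p - q‖ < 1 / 2) :
    Literature.Analysis.FluidPDE.Torus.euclidDist (Literature.Analysis.FunctionSpaces.Torus.proj p) (Literature.Analysis.FunctionSpaces.Torus.proj q) = ‖p - q‖ := by
  have hsub : Literature.Analysis.FunctionSpaces.Torus.proj p - Literature.Analysis.FunctionSpaces.Torus.proj q = Literature.Analysis.FunctionSpaces.Torus.proj (p - q) := by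
    rw [sub_eq_add_neg, ← Literature.Analysis.FunctionSpaces.Torus.proj_neg, ← Literature.Analysis.FunctionSpaces.Torus.proj_add, ← sub_eq_add_neg]
  rw [Literature.Analysis.FluidPDE.Torus.euclidDist_eq, hsub, reprSym_proj_of_norm_lt h]

/-- The minimal-image norm of `proj q`, `q` in the cube, is `‖q‖`. [folklore] -/
theorem euclidDist_proj_zero_of_mem_symCube {q : E3} (hq : q ∈ Literature.Analysis.FluidPDE.Torus.symCube (Fin 3)) :
    Literature.Analysis.FluidPDE.Torus.euclidDist (Literature.Analysis.FunctionSpaces.Torus.proj q) 0 = ‖q‖ := by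
  rw [Literature.Analysis.FluidPDE.Torus.euclidDist_eq, sub_zero, reprSym_proj_of_mem_symCube' hq]

/-! ### Euclidean overlap and the lifted Ursell coefficient -/

/-- Euclidean overlap at scale `ε`. [folklore] -/
def OvE (ε : ℝ) (a b : E3) : Prop := ‖a - b‖ < ε

/-- Euclidean overlap is symmetric. [folklore] -/
theorem ovE_symm (ε : ℝ) : ∀ a b : E3, OvE ε a b → OvE ε b a := by
  intro a b h; unfold OvE at h ⊢; rwa [norm_sub_rev]

/-- The **lifted Ursell coefficient** of `k'+1` points `(0, u₁, …, u_{k'})` of `ℝ³` at scale `ε`.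
[folklore] -/
def cE (ε : ℝ) {k' : ℕ} (u : Fin k' → E3) : ℝ :=
  uR (OvE ε) (Fin.cons (0 : E3) u) univ

/-- The torus Ursell coefficient of `(0, t₁, …, t_{k'})`. [folklore] -/
def cT (ε : ℝ) {k' : ℕ} (t : Fin k' → T3) : ℝ :=
  uR (Ov ε) (Fin.cons (0 : T3) t) univ

/-- **Locality, Euclidean**: if `cE ε u ≠ 0` then all points are within `k' ε` of each other and of
the origin. [folklore] -/
theorem norm_sub_le_of_cE_ne_zero {ε : ℝ} (hε : 0 ≤ ε) {k' : ℕ} {u : Fin k' → E3} (h : cE ε u ≠ 0)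
    (a b : Fin (k' + 1)) :
    ‖(Fin.cons (0 : E3) u : Fin (k' + 1) → E3) a - (Fin.cons (0 : E3) u : Fin (k' + 1) → E3) b‖ ≤ k' * ε := by
  have hne : hcUrsell (overlapRel (OvE ε) (Fin.cons (0 : E3) u)) univ ≠ 0 := by
    intro h0; exact h (by simp [cE, uR, h0])
  have := hcUrsell_ne_zero_le (H := overlapRel (OvE ε) (Fin.cons (0 : E3) u))
    (overlapRel_symm (ovE_symm ε) _) (fun a b => ‖(Fin.cons (0 : E3) u : Fin (k' + 1) → E3) a -
      (Fin.cons (0 : E3) u : Fin (k' + 1) → E3) b‖) hε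
    (fun a b c => norm_sub_le_norm_sub_add_norm_sub _ _ _) (fun a => by simp)
    (fun a b hab => le_of_lt hab.2) hne a (mem_univ a) b (mem_univ b)
  simpa using this

/-- **Locality, torus**: if `cT ε t ≠ 0` then all points are within `k' ε` of each other.
[folklore] -/
theorem euclidDist_le_of_cT_ne_zero {ε : ℝ} (hε : 0 ≤ ε) {k' : ℕ} {t : Fin k' → T3} (h : cT ε t ≠ 0)
    (a b : Fin (k' + 1)) :
    Literature.Analysis.FluidPDE.Torus.euclidDist ((Fin.cons (0 : T3) t : Fin (k' + 1) → T3) a)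
      ((Fin.cons (0 : T3) t : Fin (k' + 1) → T3) b) ≤ k' * ε := by
  have hne : hcUrsell (overlapRel (Ov ε) (Fin.cons (0 : T3) t)) univ ≠ 0 := by
    intro h0; exact h (by simp [cT, uR, h0])
  have := hcUrsell_ne_zero_le (H := overlapRel (Ov ε) (Fin.cons (0 : T3) t))
    (overlapRel_symm (ov_symm ε) _) (fun a b => Literature.Analysis.FluidPDE.Torus.euclidDist ((Fin.cons (0 : T3) t : Fin (k' + 1) → T3) a)
      ((Fin.cons (0 : T3) t : Fin (k' + 1) → T3) b)) hε
    (fun a b c => euclidDist_triangle _ _ _) (fun a => by simp)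
    (fun a b hab => le_of_lt hab.2) hne a (mem_univ a) b (mem_univ b)
  simpa using this

/-- `proj` commutes with `Fin.cons 0`. [folklore] -/
theorem proj_cons {k' : ℕ} (u : Fin k' → E3) :
    (fun a => Literature.Analysis.FunctionSpaces.Torus.proj ((Fin.cons (0 : E3) u : Fin (k' + 1) → E3) a)) =
      (Fin.cons (0 : T3) (fun j => Literature.Analysis.FunctionSpaces.Torus.proj (u j)) : Fin (k' + 1) → T3) := by
  funext a
  refine Fin.cases ?_ (fun j => ?_) a
  · simp [Literature.Analysis.FunctionSpaces.Torus.proj_zero]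
  · simp

/-- **The chart lemma for the Ursell coefficient.** For `u` in the cube and `k' ε < 1/4`, the torus
Ursell coefficient of `(0, proj u₁, …)` is the Euclidean one of `(0, u₁, …)`: whenever either is
nonzero all points are within `1/4` of the origin, where the chart is an isometry. [folklore] -/
theorem cT_proj_eq_cE {ε : ℝ} (hε : 0 ≤ ε) {k' : ℕ} (hk : (k' : ℝ) * ε < 1 / 4) {u : Fin k' → E3}
    (hu : ∀ j, u j ∈ Literature.Analysis.FluidPDE.Torus.symCube (Fin 3)) :
    cT ε (fun j => Literature.Analysis.FunctionSpaces.Torus.proj (u j)) = cE ε u := by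
  -- if all the lifted points are within `1/4` of the origin, the overlap graphs agree
  have key : (∀ j, ‖u j‖ ≤ k' * ε) → cT ε (fun j => Literature.Analysis.FunctionSpaces.Torus.proj (u j)) = cE ε u := by
    intro hsmall
    unfold cT cE uR
    congr 1
    refine hcUrsell_congr fun a _ b _ => ?_
    simp only [overlapRel, Ov, OvE]
    refine and_congr_right fun _ => ?_
    have hab : ‖(Fin.cons (0 : E3) u : Fin (k' + 1) → E3) a - (Fin.cons (0 : E3) u : Fin (k' + 1) → E3) b‖ < 1 / 2 := by
      have hbound : ∀ c : Fin (k' + 1), ‖(Fin.cons (0 : E3) u : Fin (k' + 1) → E3) c‖ ≤ k' * ε := by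
        intro c
        refine Fin.cases ?_ (fun j => ?_) c
        · simp; positivity
        · simpa using hsmall j
      calc _ ≤ ‖(Fin.cons (0 : E3) u : Fin (k' + 1) → E3) a‖ + ‖(Fin.cons (0 : E3) u : Fin (k' + 1) → E3) b‖ :=
            norm_sub_le _ _
        _ ≤ k' * ε + k' * ε := add_le_add (hbound a) (hbound b)
        _ < 1 / 2 := by linarith
    have hcons : ∀ c : Fin (k' + 1), (Fin.cons (0 : T3) (fun j => Literature.Analysis.FunctionSpaces.Torus.proj (u j)) : Fin (k' + 1) → T3) c =
        Literature.Analysis.FunctionSpaces.Torus.proj ((Fin.cons (0 : E3) u : Fin (k' + 1) → E3) c) := by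
      intro c; rw [← proj_cons]
    rw [hcons a, hcons b, euclidDist_proj_proj_of_norm_lt hab]
  by_cases hE : cE ε u = 0
  · by_cases hT : cT ε (fun j => Literature.Analysis.FunctionSpaces.Torus.proj (u j)) = 0
    · rw [hE, hT]
    · -- torus locality: all `proj (u j)` are within `k' ε` of `0`, hence `‖u j‖ ≤ k' ε`
      refine key fun j => ?_
      have h := euclidDist_le_of_cT_ne_zero hε hT (Fin.succ j) 0
      simp only [Fin.cons_succ, Fin.cons_zero] at h
      rwa [euclidDist_proj_zero_of_mem_symCube (hu j)] at h
  · refine key fun j => ?_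
    have h := norm_sub_le_of_cE_ne_zero hε hE (Fin.succ j) 0
    simpa using h

/-- The support of the lifted Ursell coefficient: `cE ε u ≠ 0 → ‖u j‖ ≤ k' ε`. [folklore] -/
theorem norm_le_of_cE_ne_zero {ε : ℝ} (hε : 0 ≤ ε) {k' : ℕ} {u : Fin k' → E3} (h : cE ε u ≠ 0)
    (j : Fin k') : ‖u j‖ ≤ k' * ε := by
  simpa using norm_sub_le_of_cE_ne_zero hε h (Fin.succ j) 0

/-- **Scaling of the lifted Ursell coefficient**: `cE ε (ε • z) = cE 1 z` for `ε > 0`. [folklore] -/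
theorem cE_smul {ε : ℝ} (hε : 0 < ε) {k' : ℕ} (z : Fin k' → E3) : cE ε (ε • z) = cE 1 z := by
  unfold cE uR
  congr 1
  refine hcUrsell_congr fun a _ b _ => ?_
  simp only [overlapRel, OvE]
  refine and_congr_right fun _ => ?_
  have hcons : (Fin.cons (0 : E3) (ε • z) : Fin (k' + 1) → E3) = ε • (Fin.cons (0 : E3) z : Fin (k' + 1) → E3) := by
    funext c
    refine Fin.cases ?_ (fun j => ?_) c
    · simp
    · simp
  rw [hcons, Pi.smul_apply, Pi.smul_apply, ← smul_sub, norm_smul, Real.norm_of_nonneg hε.le]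
  constructor
  · intro h; nlinarith
  · intro h; nlinarith

/-- `|cE| ≤ hcUrsellBound univ`. [folklore] -/
theorem abs_cE_le (ε : ℝ) {k' : ℕ} (u : Fin k' → E3) :
    |cE ε u| ≤ hcUrsellBound (univ : Finset (Fin (k' + 1))) := abs_uR_le _ _

/-- `cE ε` is measurable in the configuration. [folklore] -/
theorem measurable_cE (ε : ℝ) (k' : ℕ) : Measurable fun u : Fin k' → E3 => cE ε u := by
  unfold cE
  have hO : MeasurableSet {p : E3 × E3 | OvE ε p.1 p.2} :=
    (isOpen_lt (continuous_fst.sub continuous_snd).norm continuous_const).measurableSet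
  have hm := measurable_uR (ι := Fin (k' + 1)) hO (univ : Finset (Fin (k' + 1)))
  exact hm.comp (measurable_pi_lambda _ fun c => Fin.cases (by simp)
    (fun j => by simpa using measurable_pi_apply j) c)

/-- `cT ε` is measurable in the configuration. [folklore] -/
theorem measurable_cT (ε : ℝ) (k' : ℕ) : Measurable fun t : Fin k' → T3 => cT ε t := by
  unfold cT
  have hm := measurable_uR (ι := Fin (k' + 1)) (measurableSet_ov ε) (univ : Finset (Fin (k' + 1)))
  exact hm.comp (measurable_pi_lambda _ fun c => Fin.cases (by simp)
    (fun j => by simpa using measurable_pi_apply j) c)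

/-! ### The cluster integral: density, splitting off the marked point, translation -/

/-- Translating all points does not change the Ursell weight: the overlap graph of
`(y₀, y₀ + t₁, …)` is that of `(0, t₁, …)`. [folklore] -/
theorem uR_cons_translate (ε : ℝ) {k' : ℕ} (y0 : T3) (t : Fin k' → T3) :
    uR (Ov ε) (Fin.cons y0 (fun j => y0 + t j) : Fin (k' + 1) → T3) univ = cT ε t := by
  unfold cT uR
  congr 1
  refine hcUrsell_congr fun a _ b _ => ?_
  simp only [overlapRel, Ov]
  refine and_congr_right fun _ => ?_
  have hcons : ∀ c : Fin (k' + 1), (Fin.cons y0 (fun j => y0 + t j) : Fin (k' + 1) → T3) c =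
      y0 + (Fin.cons (0 : T3) t : Fin (k' + 1) → T3) c := by
    intro c
    refine Fin.cases ?_ (fun j => ?_) c
    · simp
    · simp
  rw [hcons a, hcons b, euclidDist_add_left]

/-- The product measure of the one-particle laws has density `∏ β(yᵢ)` with respect to Haar
measure. [folklore] -/
theorem pi_μ_eq_withDensity (P : DensityProfile) (m : ℕ) :
    (Measure.pi fun _ : Fin m => P.μ) =
      (volume : Measure (Fin m → T3)).withDensity (fun y => ∏ i, ENNReal.ofReal (P.β (y i))) := by
  rw [volume_pi]
  exact pi_withDensity_eq (fun _ : Fin m => (volume : Measure T3))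
    (f := fun _ y => ENNReal.ofReal (P.β y))
    (fun _ => ENNReal.measurable_ofReal.comp P.continuous.measurable) (fun _ => inferInstance)

/-- Integration against the product of the one-particle laws. [folklore] -/
theorem integral_pi_μ (P : DensityProfile) (m : ℕ) (F : (Fin m → T3) → ℝ) :
    ∫ y, F y ∂Measure.pi (fun _ : Fin m => P.μ) = ∫ y, (∏ i, P.β (y i)) * F y := by
  rw [pi_μ_eq_withDensity, integral_withDensity_eq_integral_toReal_smul]
  · refine integral_congr_ae (ae_of_all _ fun y => ?_)
    dsimp only
    rw [ENNReal.toReal_prod, smul_eq_mul]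
    congr 1
    exact Finset.prod_congr rfl fun i _ => ENNReal.toReal_ofReal (P.pos _).le
  · exact Finset.measurable_prod _ fun i _ =>
      ENNReal.measurable_ofReal.comp (P.continuous.measurable.comp (measurable_pi_apply i))
  · exact ae_of_all _ fun y => ENNReal.prod_lt_top fun i _ => ENNReal.ofReal_lt_top

/-- **The cluster integral with the marked point split off and the others translated**:
`W^g(k'+1) = ∫ g(y₀) β(y₀) (∫ cT_ε(t) ∏ⱼ β(y₀ + tⱼ) dt) dy₀`. [folklore] -/
theorem Wd_self_eq_integral_translate (P : DensityProfile) (ε : ℝ) (k' : ℕ) {g : T3 → ℝ}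
    (hg : Measurable g) {C : ℝ} (hgC : ∀ y, |g y| ≤ C) :
    Wd P ε (k' + 1) g (k' + 1) =
      ∫ y0 : T3, g y0 * P.β y0 * ∫ t : Fin k' → T3, cT ε t * ∏ j, P.β (y0 + t j) := by
  -- Step 0: the definition and the density
  rw [Wd, decAct, firstLabels_self, integral_pi_μ]
  -- the integrand on the full configuration space
  set G : (Fin (k' + 1) → T3) → ℝ := fun y => (∏ i, P.β (y i)) * (g (y 0) * uR (Ov ε) y univ) with hG
  have hGm : Measurable G :=
    (Finset.measurable_prod _ fun i _ => P.continuous.measurable.comp (measurable_pi_apply i)).mul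
      ((hg.comp (measurable_pi_apply 0)).mul (measurable_uR (measurableSet_ov ε) _))
  have hGb : ∀ y, |G y| ≤ P.M ^ (k' + 1) * (C * hcUrsellBound (univ : Finset (Fin (k' + 1)))) := by
    intro y
    rw [hG, abs_mul, abs_mul]
    refine mul_le_mul ?_ (mul_le_mul (hgC _) (abs_uR_le y _) (abs_nonneg _)
      ((abs_nonneg _).trans (hgC 0))) (by positivity) (pow_nonneg P.M_pos.le _)
    rw [Finset.abs_prod]
    calc ∏ i, |P.β (y i)| ≤ ∏ _i : Fin (k' + 1), P.M :=
          Finset.prod_le_prod (fun i _ => abs_nonneg _) fun i _ =>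
            (abs_of_pos (P.pos _)).trans_le (P.le_M _)
      _ = P.M ^ (k' + 1) := by simp
  -- Step 1: split off the marked coordinate `0`
  set e := MeasurableEquiv.piFinSuccAbove (fun _ : Fin (k' + 1) => T3) 0 with he
  have hv : MeasurePreserving e.symm (volume : Measure (T3 × (Fin k' → T3))) volume :=
    (volume_preserving_piFinSuccAbove (fun _ : Fin (k' + 1) => T3) 0).symm
  rw [← hv.integral_comp']
  have hsymm : ∀ p : T3 × (Fin k' → T3), e.symm p = Fin.cons p.1 p.2 := by
    intro p
    simp [he, MeasurableEquiv.piFinSuccAbove_symm_apply, Fin.insertNthEquiv, Fin.insertNth_zero']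
  simp_rw [hsymm]
  -- integrability on the product space (bounded, measurable, finite measure)
  have hint : Integrable (fun p : T3 × (Fin k' → T3) => G (Fin.cons p.1 p.2))
      ((volume : Measure T3).prod volume) := by
    have hm : Measurable fun p : T3 × (Fin k' → T3) => G (Fin.cons p.1 p.2) := by
      refine hGm.comp (measurable_pi_lambda _ fun c => Fin.cases (by simpa using measurable_fst)
        (fun j => by simpa [Function.comp_def] using (measurable_pi_apply j).comp measurable_snd) c)
    refine Integrable.mono' (integrable_const (P.M ^ (k' + 1) * (C * hcUrsellBound (univ : Finset (Fin (k' + 1))))))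
      hm.aestronglyMeasurable (ae_of_all _ fun p => ?_)
    rw [Real.norm_eq_abs]
    exact hGb _
  rw [show (volume : Measure (T3 × (Fin k' → T3))) = (volume : Measure T3).prod volume from rfl,
    integral_prod _ hint]
  -- Step 2: simplify the integrand and translate the inner integral
  refine integral_congr_ae (ae_of_all _ fun y0 => ?_)
  have hinner : ∀ y' : Fin k' → T3, G (Fin.cons y0 y') =
      g y0 * P.β y0 * ((∏ j, P.β (y' j)) * uR (Ov ε) (Fin.cons y0 y') univ) := by
    intro y'
    simp only [hG, Fin.prod_univ_succ, Fin.cons_zero, Fin.cons_succ]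
    ring
  simp_rw [hinner]
  rw [integral_const_mul]
  congr 1
  -- translate `y' = (y₀, …, y₀) + t`, coordinatewise
  have hT : MeasurePreserving (MeasurableEquiv.piCongrRight fun _ : Fin k' => MeasurableEquiv.addLeft y0)
      (volume : Measure (Fin k' → T3)) volume := by
    rw [volume_pi]
    exact measurePreserving_pi _ _ fun _ => measurePreserving_add_left volume y0
  rw [← hT.integral_comp']
  refine integral_congr_ae (ae_of_all _ fun t => ?_)
  have h1 : ((MeasurableEquiv.piCongrRight fun _ : Fin k' => MeasurableEquiv.addLeft y0) t) =
      fun j => y0 + t j := rfl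
  dsimp only
  rw [h1, uR_cons_translate, mul_comm]

/-! ### Lifting the cluster integral to `ℝ³` and scaling -/

/-- The product of symmetric cubes. [folklore] -/
def cubes (k' : ℕ) : Set (Fin k' → E3) := Set.pi Set.univ fun _ => Literature.Analysis.FluidPDE.Torus.symCube (Fin 3)

/-- The product of cubes is measurable. [folklore] -/
theorem measurableSet_cubes (k' : ℕ) : MeasurableSet (cubes k') :=
  MeasurableSet.univ_pi fun _ => Literature.Analysis.FluidPDE.Torus.measurableSet_symCube

/-- The symmetric cube has finite Lebesgue measure. [folklore] -/
theorem volume_symCube_lt_top : volume (Literature.Analysis.FluidPDE.Torus.symCube (Fin 3)) < ⊤ := by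
  refine (measure_mono ?_).trans_lt (measure_closedBall_lt_top (x := (0 : E3)) (r := Real.sqrt 3))
  intro q hq
  rw [Metric.mem_closedBall, dist_zero_right, EuclideanSpace.norm_eq]
  refine Real.sqrt_le_sqrt ?_
  calc ∑ i, ‖q i‖ ^ 2 ≤ ∑ _i : Fin 3, (1 : ℝ) := Finset.sum_le_sum fun i _ => by
        have h := hq i
        rw [Real.norm_eq_abs, sq_abs]
        nlinarith [h.1, h.2]
    _ = 3 := by simp

/-- **The coordinatewise covering map pushes Lebesgue measure on the cubes to Haar measure.**
[folklore] -/
theorem map_proj_pi_restrict_cubes (k' : ℕ) :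
    ((volume : Measure (Fin k' → E3)).restrict (cubes k')).map
        (fun u j => Literature.Analysis.FunctionSpaces.Torus.proj (u j)) = (volume : Measure (Fin k' → T3)) := by
  haveI : IsFiniteMeasure ((volume : Measure E3).restrict (Literature.Analysis.FluidPDE.Torus.symCube (Fin 3))) :=
    ⟨by rw [Measure.restrict_apply_univ]; exact volume_symCube_lt_top⟩
  rw [volume_pi, cubes, Measure.restrict_pi_pi, Measure.pi_map_pi fun _ =>
    Literature.Analysis.FunctionSpaces.Torus.measurable_proj.aemeasurable]
  congr 1
  funext j
  exact Literature.Analysis.FluidPDE.Torus.map_proj_volume_restrict_symCube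

/-- **Lifting the translated cluster integral to `ℝ³`**: for `k' ε < 1/4`,
`∫ cT_ε(t) ∏ β(y₀ + tⱼ) dt = ∫_{ℝ^{3k'}} cE_ε(u) ∏ β(y₀ + proj uⱼ) du` (the integrand on the right is
supported where all `‖uⱼ‖ ≤ k' ε`, inside the cube, and there the chart identifies the two Ursell
coefficients). [folklore] -/
theorem integral_cT_eq_integral_cE (P : DensityProfile) {ε : ℝ} (hε : 0 ≤ ε) {k' : ℕ}
    (hk : (k' : ℝ) * ε < 1 / 4) (y0 : T3) :
    ∫ t : Fin k' → T3, cT ε t * ∏ j, P.β (y0 + t j) =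
      ∫ u : Fin k' → E3, cE ε u * ∏ j, P.β (y0 + Literature.Analysis.FunctionSpaces.Torus.proj (u j)) := by
  set Φ : (Fin k' → T3) → ℝ := fun t => cT ε t * ∏ j, P.β (y0 + t j) with hΦ
  have hΦm : Measurable Φ := (measurable_cT ε k').mul (Finset.measurable_prod _ fun j _ =>
    P.continuous.measurable.comp (measurable_const.add (measurable_pi_apply j)))
  have hL : Measurable fun (u : Fin k' → E3) (j : Fin k') => Literature.Analysis.FunctionSpaces.Torus.proj (u j) :=
    measurable_pi_lambda _ fun j => Literature.Analysis.FunctionSpaces.Torus.measurable_proj.comp (measurable_pi_apply j)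
  -- pull back along the covering map
  have step1 : ∫ t, Φ t = ∫ u in cubes k', Φ (fun j => Literature.Analysis.FunctionSpaces.Torus.proj (u j)) := by
    rw [← map_proj_pi_restrict_cubes k', integral_map hL.aemeasurable hΦm.aestronglyMeasurable]
  rw [step1]
  -- on the cube the two integrands agree
  have step2 : ∫ u in cubes k', Φ (fun j => Literature.Analysis.FunctionSpaces.Torus.proj (u j)) =
      ∫ u in cubes k', cE ε u * ∏ j, P.β (y0 + Literature.Analysis.FunctionSpaces.Torus.proj (u j)) := by
    refine setIntegral_congr_fun (measurableSet_cubes k') fun u hu => ?_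
    simp only [hΦ]
    rw [cT_proj_eq_cE hε hk fun j => hu j (Set.mem_univ j)]
  rw [step2]
  -- the integrand vanishes off the cube
  refine setIntegral_eq_integral_of_forall_compl_eq_zero fun u hu => ?_
  by_cases hc : cE ε u = 0
  · rw [hc, zero_mul]
  · exfalso
    refine hu fun j _ => mem_symCube_of_norm_lt ?_
    exact (norm_le_of_cE_ne_zero hε hc j).trans_lt (by linarith)

/-- The **rescaled cluster integrand**
`J_ε(y₀) = ∫_{ℝ^{3k'}} cE₁(z) ∏ⱼ β(y₀ + proj (ε zⱼ)) dz`. [folklore] -/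
def Jint (P : DensityProfile) (ε : ℝ) (k' : ℕ) (y0 : T3) : ℝ :=
  ∫ z : Fin k' → E3, cE 1 z * ∏ j, P.β (y0 + Literature.Analysis.FunctionSpaces.Torus.proj (ε • z j))

/-- **Scaling**: `∫ cE_ε(u) ∏ β(y₀ + proj uⱼ) du = ε^{3k'} J_ε(y₀)` for `ε > 0`. [folklore] -/
theorem integral_cE_eq_pow_mul_Jint (P : DensityProfile) {ε : ℝ} (hε : 0 < ε) (k' : ℕ) (y0 : T3) :
    ∫ u : Fin k' → E3, cE ε u * ∏ j, P.β (y0 + Literature.Analysis.FunctionSpaces.Torus.proj (u j)) = ε ^ (3 * k') * Jint P ε k' y0 := by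
  set f : (Fin k' → E3) → ℝ := fun u => cE ε u * ∏ j, P.β (y0 + Literature.Analysis.FunctionSpaces.Torus.proj (u j)) with hf
  have h := Measure.integral_comp_smul (volume : Measure (Fin k' → E3)) f ε
  have hdim : Module.finrank ℝ (Fin k' → E3) = 3 * k' := by
    rw [Module.finrank_pi_fintype]; simp [mul_comm]
  rw [hdim, abs_inv, abs_of_pos (pow_pos hε _), smul_eq_mul] at h
  have hfs : ∀ z : Fin k' → E3, f (ε • z) = cE 1 z * ∏ j, P.β (y0 + Literature.Analysis.FunctionSpaces.Torus.proj (ε • z j)) := by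
    intro z
    simp only [hf, cE_smul hε, Pi.smul_apply]
  simp_rw [hfs] at h
  change ∫ u, f u = ε ^ (3 * k') * Jint P ε k' y0
  rw [Jint, h, ← mul_assoc, mul_inv_cancel₀ (pow_ne_zero _ hε.ne'), one_mul]

/-- **The exact scaling identity for the cluster integrals**: for `0 < ε` with `k' ε < 1/4`,
`W^g(k'+1) = ε^{3k'} ∫ g β J_ε`. [folklore] -/
theorem Wd_self_eq_pow_mul (P : DensityProfile) {ε : ℝ} (hε : 0 < ε) {k' : ℕ}
    (hk : (k' : ℝ) * ε < 1 / 4) {g : T3 → ℝ} (hg : Measurable g) {C : ℝ} (hgC : ∀ y, |g y| ≤ C) :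
    Wd P ε (k' + 1) g (k' + 1) = ε ^ (3 * k') * ∫ y0 : T3, g y0 * P.β y0 * Jint P ε k' y0 := by
  rw [Wd_self_eq_integral_translate P ε k' hg hgC, ← integral_const_mul]
  refine integral_congr_ae (ae_of_all _ fun y0 => ?_)
  dsimp only
  rw [integral_cT_eq_integral_cE P hε.le hk, integral_cE_eq_pow_mul_Jint P hε]
  ring

/-! ### The limits `ε → 0` by dominated convergence -/

/-- The **cluster constant** `b_{k'+1} = ∫_{ℝ^{3k'}} cE₁(z) dz` (the integrated Ursell function of
`k'+1` unit-diameter spheres with one of them pinned at the origin; `k'! ×` a Mayer coefficient).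
[folklore] -/
def bE (k' : ℕ) : ℝ := ∫ z : Fin k' → E3, cE 1 z

/-- The support box `{z | ∀ j, ‖zⱼ‖ ≤ k'}` of `cE₁`. [folklore] -/
def suppBox (k' : ℕ) : Set (Fin k' → E3) := Set.pi Set.univ fun _ => Metric.closedBall (0 : E3) k'

/-- The support box is compact. [folklore] -/
theorem isCompact_suppBox (k' : ℕ) : IsCompact (suppBox k') :=
  isCompact_univ_pi fun _ => isCompact_closedBall _ _

/-- The support box is measurable. [folklore] -/
theorem measurableSet_suppBox (k' : ℕ) : MeasurableSet (suppBox k') :=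
  (isCompact_suppBox k').isClosed.measurableSet

/-- The unit-scale Ursell coefficient vanishes off the support box. [folklore] -/
theorem mem_suppBox_of_cE_ne_zero {k' : ℕ} {z : Fin k' → E3} (h : cE 1 z ≠ 0) : z ∈ suppBox k' := by
  intro j _
  rw [Metric.mem_closedBall, dist_zero_right]
  simpa using norm_le_of_cE_ne_zero zero_le_one h j

/-- The uniform dominating function `B · M^{k'} · 𝟙[suppBox]`. [folklore] -/
def domF (P : DensityProfile) (k' : ℕ) : (Fin k' → E3) → ℝ :=
  (suppBox k').indicator fun _ => (hcUrsellBound (univ : Finset (Fin (k' + 1))) : ℝ) * P.M ^ k'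

/-- The dominating function is integrable. [folklore] -/
theorem integrable_domF (P : DensityProfile) (k' : ℕ) : Integrable (domF P k') := by
  unfold domF
  rw [integrable_indicator_iff (measurableSet_suppBox k')]
  exact integrableOn_const (isCompact_suppBox k').measure_lt_top.ne

/-- The integrands of `J_ε` are dominated by `domF`. [folklore] -/
theorem abs_integrand_le_domF (P : DensityProfile) (k' : ℕ) (ε : ℝ) (y0 : T3) (z : Fin k' → E3) :
    |cE 1 z * ∏ j, P.β (y0 + Literature.Analysis.FunctionSpaces.Torus.proj (ε • z j))| ≤ domF P k' z := by
  by_cases hc : cE 1 z = 0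
  · rw [hc, zero_mul, abs_zero]
    unfold domF
    refine Set.indicator_nonneg (fun _ _ => ?_) z
    have := P.M_pos; positivity
  · unfold domF
    rw [Set.indicator_of_mem (mem_suppBox_of_cE_ne_zero hc), abs_mul, Finset.abs_prod]
    refine mul_le_mul (abs_cE_le 1 z) ?_ (Finset.prod_nonneg fun _ _ => abs_nonneg _) (Nat.cast_nonneg _)
    calc ∏ j, |P.β (y0 + Literature.Analysis.FunctionSpaces.Torus.proj (ε • z j))| ≤ ∏ _j : Fin k', P.M :=
          Finset.prod_le_prod (fun _ _ => abs_nonneg _) fun j _ =>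
            (abs_of_pos (P.pos _)).trans_le (P.le_M _)
      _ = P.M ^ k' := by simp

/-- The integrands of `J_ε` are measurable in `z`. [folklore] -/
theorem measurable_integrand (P : DensityProfile) (k' : ℕ) (ε : ℝ) (y0 : T3) :
    Measurable fun z : Fin k' → E3 => cE 1 z * ∏ j, P.β (y0 + Literature.Analysis.FunctionSpaces.Torus.proj (ε • z j)) :=
  (measurable_cE 1 k').mul (Finset.measurable_prod _ fun j _ => P.continuous.measurable.comp
    (measurable_const.add (Literature.Analysis.FunctionSpaces.Torus.measurable_proj.comp ((measurable_pi_apply j).const_smul ε))))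

/-- **Pointwise limit of the rescaled cluster integrand**: `J_{ε_N}(y₀) → b · β(y₀)^{k'}` as
`ε_N → 0` (dominated convergence on `ℝ^{3k'}`: the lifted Ursell function has bounded support and
`β` is continuous). [folklore] -/
theorem tendsto_Jint (P : DensityProfile) (k' : ℕ) {εs : ℕ → ℝ} (hεs : Tendsto εs atTop (𝓝 0))
    (y0 : T3) : Tendsto (fun N => Jint P (εs N) k' y0) atTop (𝓝 (bE k' * P.β y0 ^ k')) := by
  have hlim : bE k' * P.β y0 ^ k' = ∫ z : Fin k' → E3, cE 1 z * P.β y0 ^ k' := by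
    rw [bE, integral_mul_const]
  rw [hlim]
  refine tendsto_integral_of_dominated_convergence (domF P k')
    (fun N => (measurable_integrand P k' (εs N) y0).aestronglyMeasurable) (integrable_domF P k')
    (fun N => ae_of_all _ fun z => (Real.norm_eq_abs _).le.trans (abs_integrand_le_domF P k' _ y0 z))
    (ae_of_all _ fun z => ?_)
  refine Tendsto.const_mul _ ?_
  have hprod : P.β y0 ^ k' = ∏ _j : Fin k', P.β y0 := by simp
  rw [hprod]
  refine tendsto_finsetProd _ fun j _ => ?_
  have hcont : Continuous fun s : ℝ => P.β (y0 + Literature.Analysis.FunctionSpaces.Torus.proj (s • z j)) :=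
    P.continuous.comp (continuous_const.add (Literature.Analysis.FunctionSpaces.Torus.continuous_proj.comp (continuous_id.smul
      continuous_const)))
  have h0 : P.β (y0 + Literature.Analysis.FunctionSpaces.Torus.proj ((0 : ℝ) • z j)) = P.β y0 := by
    rw [zero_smul, Literature.Analysis.FunctionSpaces.Torus.proj_zero, add_zero]
  rw [← h0]
  exact (hcont.tendsto 0).comp hεs

/-- `|J_ε(y₀)| ≤ ∫ domF` uniformly. [folklore] -/
theorem abs_Jint_le (P : DensityProfile) (ε : ℝ) (k' : ℕ) (y0 : T3) :
    |Jint P ε k' y0| ≤ ∫ z, domF P k' z := by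
  unfold Jint
  refine (Real.norm_eq_abs _).symm.trans_le ((norm_integral_le_integral_norm _).trans ?_)
  refine integral_mono_of_nonneg (ae_of_all _ fun z => norm_nonneg _) (integrable_domF P k')
    (ae_of_all _ fun z => ?_)
  dsimp only
  rw [Real.norm_eq_abs]
  exact abs_integrand_le_domF P k' ε y0 z

/-- `y₀ ↦ J_ε(y₀)` is measurable (Fubini measurability of a parametric integral). [folklore] -/
theorem measurable_Jint (P : DensityProfile) (ε : ℝ) (k' : ℕ) : Measurable fun y0 => Jint P ε k' y0 := by
  unfold Jint
  have hm : Measurable (Function.uncurry fun (y0 : T3) (z : Fin k' → E3) =>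
      cE 1 z * ∏ j, P.β (y0 + Literature.Analysis.FunctionSpaces.Torus.proj (ε • z j))) := by
    refine ((measurable_cE 1 k').comp measurable_snd).mul (Finset.measurable_prod _ fun j _ => ?_)
    exact P.continuous.measurable.comp (measurable_fst.add (Literature.Analysis.FunctionSpaces.Torus.measurable_proj.comp
      (((measurable_pi_apply j).comp measurable_snd).const_smul ε)))
  exact (hm.stronglyMeasurable.integral_prod_right (ν := (volume : Measure (Fin k' → E3)))).measurable

/-- **Limit of the outer integral**: `∫ g β J_{ε_N} → b ∫ g β^{k'+1}` (dominated convergence on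
`𝕋³`, the integrands being uniformly bounded). [folklore] -/
theorem tendsto_integral_Jint (P : DensityProfile) (k' : ℕ) {εs : ℕ → ℝ} (hεs : Tendsto εs atTop (𝓝 0))
    {g : T3 → ℝ} (hg : Measurable g) {C : ℝ} (hgC : ∀ y, |g y| ≤ C) :
    Tendsto (fun N => ∫ y0 : T3, g y0 * P.β y0 * Jint P (εs N) k' y0) atTop
      (𝓝 (bE k' * ∫ y0 : T3, g y0 * P.β y0 ^ (k' + 1))) := by
  have hlim : bE k' * ∫ y0 : T3, g y0 * P.β y0 ^ (k' + 1) =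
      ∫ y0 : T3, g y0 * P.β y0 * (bE k' * P.β y0 ^ k') := by
    rw [← integral_const_mul]
    refine integral_congr_ae (ae_of_all _ fun y0 => ?_)
    ring
  rw [hlim]
  refine tendsto_integral_of_dominated_convergence (fun _ => C * P.M * ∫ z, domF P k' z)
    (fun N => ?_) (integrable_const _) (fun N => ae_of_all _ fun y0 => ?_)
    (ae_of_all _ fun y0 => (tendsto_Jint P k' hεs y0).const_mul _)
  · exact (((hg.mul P.continuous.measurable)).mul (measurable_Jint P (εs N) k')).aestronglyMeasurable
  · rw [Real.norm_eq_abs, abs_mul, abs_mul]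
    have hC0 : 0 ≤ C := (abs_nonneg _).trans (hgC y0)
    refine mul_le_mul (mul_le_mul (hgC _) ((abs_of_pos (P.pos _)).trans_le (P.le_M _))
      (abs_nonneg _) hC0) (abs_Jint_le P _ k' y0) (abs_nonneg _) (mul_nonneg hC0 P.M_pos.le)

/-! ### Marginalisation: the activities only involve the block -/

/-- The first `k` labels of `Fin n` are the image of `Fin k` under `Fin.castLE`. [folklore] -/
theorem map_castLEEmb_univ {k n : ℕ} (h : k ≤ n) :
    (univ : Finset (Fin k)).map (Fin.castLEEmb h) = firstLabels n k := by
  ext i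
  simp only [Finset.mem_map, Finset.mem_univ, true_and, mem_firstLabels]
  constructor
  · rintro ⟨j, rfl⟩; exact j.isLt
  · intro hi; exact ⟨⟨i, hi⟩, Fin.ext rfl⟩

/-- Restricting a configuration to the first `k` labels transports the Ursell weight of the block
`firstLabels n k` to that of all labels. [folklore] -/
theorem uR_firstLabels_eq {k n : ℕ} (h : k ≤ n) (ε : ℝ) (x : Fin n → T3) :
    uR (Ov ε) x (firstLabels n k) = uR (Ov ε) (fun i : Fin k => x (Fin.castLE h i)) univ := by
  unfold uR
  rw [← map_castLEEmb_univ h, hcUrsell_map (Fin.castLEEmb h)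
    (H := overlapRel (Ov ε) (fun i : Fin k => x (Fin.castLE h i))) (H' := overlapRel (Ov ε) x)]
  intro a b
  simp only [overlapRel, Fin.coe_castLEEmb, (Fin.castLE_injective h).ne_iff]

/-- **Marginalisation**: an integrand depending only on the first `k` coordinates integrates the
same against `μ^{⊗n}` and `μ^{⊗k}`. [folklore] -/
theorem integral_pi_comp_castLE (P : DensityProfile) {k n : ℕ} (h : k ≤ n) {F : (Fin k → T3) → ℝ}
    (hF : Measurable F) :
    ∫ x, F (fun i => x (Fin.castLE h i)) ∂Measure.pi (fun _ : Fin n => P.μ) =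
      ∫ y, F y ∂Measure.pi (fun _ : Fin k => P.μ) := by
  set s : Finset (Fin n) := firstLabels n k with hs
  -- the bijection `Fin k ≃ s`
  set e : Fin k ≃ {j // j ∈ s} :=
    { toFun := fun i => ⟨Fin.castLE h i, mem_firstLabels.2 (by simp)⟩
      invFun := fun j => ⟨j.1.1, mem_firstLabels.1 j.2⟩
      left_inv := fun i => by ext; simp
      right_inv := fun j => by ext; simp } with he
  -- `F` on `Fin k` as a function on `s`
  set G : ({j // j ∈ s} → T3) → ℝ := fun w => F (fun i => w (e i)) with hG
  have hGm : Measurable G := hF.comp (measurable_pi_lambda _ fun i => measurable_pi_apply _)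
  have h1 : ∀ x : Fin n → T3, F (fun i => x (Fin.castLE h i)) = G (s.restrict x) := fun x => rfl
  simp_rw [h1]
  rw [← Measure.infinitePi_eq_pi, integral_restrict_infinitePi (μ := fun _ : Fin n => P.μ)
    hGm.aestronglyMeasurable]
  -- relabel `s ≃ Fin k`
  have hmp := (measurePreserving_piCongrLeft (fun _ : {j // j ∈ s} => P.μ) e).symm
  rw [← hmp.integral_comp']
  rfl

/-- **The activities only involve the block**: `W^g(k)` computed among `n ≥ k` particles equals the
same quantity for `k` particles. [folklore] -/
theorem Wd_eq_Wd_self (P : DensityProfile) (ε : ℝ) {k n : ℕ} [NeZero k] [NeZero n] (h : k ≤ n)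
    {g : T3 → ℝ} (hg : Measurable g) : Wd P ε n g k = Wd P ε k g k := by
  rw [Wd, Wd, decAct, decAct, firstLabels_self]
  have hF : Measurable fun y : Fin k → T3 => g (y 0) * uR (Ov ε) y univ :=
    (hg.comp (measurable_pi_apply 0)).mul (measurable_uR (measurableSet_ov ε) _)
  rw [← integral_pi_comp_castLE P h hF]
  refine integral_congr_ae (ae_of_all _ fun x => ?_)
  dsimp only
  rw [uR_firstLabels_eq h]
  congr 2

/-! ### The limit of the combinatorial prefactor and the cluster limit -/

/-- `ε_N = σ (N+1)^{-1/3} → 0`. [folklore] -/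
theorem tendsto_hsDiameter (σ : ℝ) : Tendsto (fun N => hsDiameter σ N) atTop (𝓝 0) := by
  have h1 : Tendsto (fun N : ℕ => (((N + 1 : ℕ) : ℝ))) atTop atTop := by
    exact tendsto_natCast_atTop_atTop.comp (tendsto_add_atTop_nat 1)
  have h2 := (tendsto_rpow_neg_atTop (by norm_num : (0 : ℝ) < 1 / 3)).comp h1
  have h3 := h2.const_mul σ
  rw [mul_zero] at h3
  exact h3

/-- `ε_N³ = σ³ / (N+1)`. [folklore] -/
theorem hsDiameter_pow_three (σ : ℝ) (N : ℕ) : hsDiameter σ N ^ 3 = σ ^ 3 / (N + 1 : ℕ) := by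
  have h := succ_mul_hsDiameter_pow_three σ N
  have hN : (0 : ℝ) < (N + 1 : ℕ) := by positivity
  field_simp
  linarith

/-- **The combinatorial prefactor**: `C(N, k') ε_N^{3k'} → σ^{3k'} / k'!`. [folklore] -/
theorem tendsto_choose_mul_hsDiameter_pow (σ : ℝ) (k' : ℕ) :
    Tendsto (fun N : ℕ => (N.choose k' : ℝ) * hsDiameter σ N ^ (3 * k')) atTop
      (𝓝 ((σ ^ 3) ^ k' / k'.factorial)) := by
  have hr : Tendsto (fun N : ℕ => (N : ℝ) * (σ ^ 3 / (N + 1 : ℕ))) atTop (𝓝 (σ ^ 3)) := by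
    have h1 : Tendsto (fun N : ℕ => (N : ℝ) / (N + 1 : ℕ)) atTop (𝓝 1) := by
      have := tendsto_natCast_div_add_atTop (1 : ℝ)
      refine this.congr fun N => ?_
      push_cast; rfl
    have h2 := h1.const_mul (σ ^ 3)
    rw [mul_one] at h2
    refine h2.congr fun N => ?_
    ring
  have h := ProbabilityTheory.tendsto_choose_mul_pow_atTop k' hr
  refine h.congr fun N => ?_
  rw [pow_mul, hsDiameter_pow_three]

/-- The limit coefficient `γ_{k'+1} = σ^{3k'} b_{k'+1} / k'!`. [folklore] -/
def clusterCoeff (σ : ℝ) (k' : ℕ) : ℝ := (σ ^ 3) ^ k' / k'.factorial * bE k'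

/-- **The cluster limit.** For `σ > 0`, continuous-bounded `g` and every `k'`,
`C(N, k') · W^g_{N+1}(k'+1) → γ_{k'+1} ∫ g β^{k'+1}` as `N → ∞` at the scale
`ε_N = σ (N+1)^{-1/3}`. [folklore] -/
theorem tendsto_choose_mul_Wd (P : DensityProfile) {σ : ℝ} (hσ : 0 < σ) (k' : ℕ) {g : T3 → ℝ}
    (hg : Measurable g) {C : ℝ} (hgC : ∀ y, |g y| ≤ C) :
    Tendsto (fun N : ℕ => (N.choose k' : ℝ) * Wd P (hsDiameter σ N) (N + 1) g (k' + 1)) atTop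
      (𝓝 (clusterCoeff σ k' * ∫ y0 : T3, g y0 * P.β y0 ^ (k' + 1))) := by
  -- eventually the exact scaling identity applies
  have hev : ∀ᶠ N : ℕ in atTop, (N.choose k' : ℝ) * Wd P (hsDiameter σ N) (N + 1) g (k' + 1) =
      ((N.choose k' : ℝ) * hsDiameter σ N ^ (3 * k')) *
        ∫ y0 : T3, g y0 * P.β y0 * Jint P (hsDiameter σ N) k' y0 := by
    have h1 : ∀ᶠ N : ℕ in atTop, k' + 1 ≤ N + 1 := by
      filter_upwards [eventually_ge_atTop k'] with N hN; omega
    have h2 : ∀ᶠ N : ℕ in atTop, (k' : ℝ) * hsDiameter σ N < 1 / 4 := by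
      have := (tendsto_hsDiameter σ).const_mul (k' : ℝ)
      rw [mul_zero] at this
      exact this.eventually (gt_mem_nhds (by norm_num))
    filter_upwards [h1, h2] with N hN1 hN2
    haveI : NeZero (k' + 1) := ⟨Nat.succ_ne_zero _⟩
    rw [Wd_eq_Wd_self P _ hN1 hg, Wd_self_eq_pow_mul P (hsDiameter_pos hσ N) hN2 hg hgC, ← mul_assoc]
  refine (Tendsto.congr' (EventuallyEq.symm hev) ?_)
  have h := (tendsto_choose_mul_hsDiameter_pow σ k').mul
    (tendsto_integral_Jint P k' (tendsto_hsDiameter σ) hg hgC)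
  have heq : clusterCoeff σ k' * ∫ y0 : T3, g y0 * P.β y0 ^ (k' + 1) =
      (σ ^ 3) ^ k' / k'.factorial * (bE k' * ∫ y0 : T3, g y0 * P.β y0 ^ (k' + 1)) := by
    rw [clusterCoeff, mul_assoc]
  rw [heq]
  exact h

/-- **The shifted combinatorial prefactor**: `C(N - s, k') ε_N^{3k'} → σ^{3k'} / k'!` for every
fixed shift `s`. [folklore] -/
theorem tendsto_choose_sub_mul_hsDiameter_pow (σ : ℝ) (s k' : ℕ) :
    Tendsto (fun N : ℕ => ((N - s).choose k' : ℝ) * hsDiameter σ N ^ (3 * k')) atTop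
      (𝓝 ((σ ^ 3) ^ k' / k'.factorial)) := by
  -- along `n = N - s`
  have hr : Tendsto (fun n : ℕ => (n : ℝ) * (σ ^ 3 / (n + s + 1 : ℕ))) atTop (𝓝 (σ ^ 3)) := by
    have h1 : Tendsto (fun n : ℕ => (n : ℝ) / ((n : ℝ) + (s + 1 : ℕ))) atTop (𝓝 1) :=
      tendsto_natCast_div_add_atTop ((s + 1 : ℕ) : ℝ)
    have h2 := h1.const_mul (σ ^ 3)
    rw [mul_one] at h2
    refine h2.congr fun n => ?_
    push_cast; ring
  have h := ProbabilityTheory.tendsto_choose_mul_pow_atTop k' hr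
  have hcomp := h.comp (tendsto_sub_atTop_nat s)
  refine hcomp.congr' ?_
  filter_upwards [eventually_ge_atTop s] with N hN
  simp only [Function.comp_apply]
  rw [pow_mul, hsDiameter_pow_three, show N - s + s + 1 = N + 1 by omega]

/-- **The cluster limit with a shifted binomial**: for every fixed `s`,
`C(N - s, k') · W^g_{N+1}(k'+1) → γ_{k'+1} ∫ g β^{k'+1}`. [folklore] -/
theorem tendsto_choose_sub_mul_Wd (P : DensityProfile) {σ : ℝ} (hσ : 0 < σ) (s k' : ℕ) {g : T3 → ℝ}
    (hg : Measurable g) {C : ℝ} (hgC : ∀ y, |g y| ≤ C) :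
    Tendsto (fun N : ℕ => ((N - s).choose k' : ℝ) * Wd P (hsDiameter σ N) (N + 1) g (k' + 1)) atTop
      (𝓝 (clusterCoeff σ k' * ∫ y0 : T3, g y0 * P.β y0 ^ (k' + 1))) := by
  have hev : ∀ᶠ N : ℕ in atTop, ((N - s).choose k' : ℝ) * Wd P (hsDiameter σ N) (N + 1) g (k' + 1) =
      (((N - s).choose k' : ℝ) * hsDiameter σ N ^ (3 * k')) *
        ∫ y0 : T3, g y0 * P.β y0 * Jint P (hsDiameter σ N) k' y0 := by
    have h1 : ∀ᶠ N : ℕ in atTop, k' + 1 ≤ N + 1 := by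
      filter_upwards [eventually_ge_atTop k'] with N hN; omega
    have h2 : ∀ᶠ N : ℕ in atTop, (k' : ℝ) * hsDiameter σ N < 1 / 4 := by
      have := (tendsto_hsDiameter σ).const_mul (k' : ℝ)
      rw [mul_zero] at this
      exact this.eventually (gt_mem_nhds (by norm_num))
    filter_upwards [h1, h2] with N hN1 hN2
    haveI : NeZero (k' + 1) := ⟨Nat.succ_ne_zero _⟩
    rw [Wd_eq_Wd_self P _ hN1 hg, Wd_self_eq_pow_mul P (hsDiameter_pos hσ N) hN2 hg hgC, ← mul_assoc]
  refine (Tendsto.congr' (EventuallyEq.symm hev) ?_)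
  have h := (tendsto_choose_sub_mul_hsDiameter_pow σ s k').mul
    (tendsto_integral_Jint P k' (tendsto_hsDiameter σ) hg hgC)
  have heq : clusterCoeff σ k' * ∫ y0 : T3, g y0 * P.β y0 ^ (k' + 1) =
      (σ ^ 3) ^ k' / k'.factorial * (bE k' * ∫ y0 : T3, g y0 * P.β y0 ^ (k' + 1)) := by
    rw [clusterCoeff, mul_assoc]
  rw [heq]
  exact h

end

end Literature.MathematicalPhysics.KineticTheory
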